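import Summits.AtomisticToContinuum.BoseEinsteinCondensation.Theorems.BECCutLineWeakDisorderAcrossCutFourPoint
import Summits.AtomisticToContinuum.BoseEinsteinCondensation.Theorems.BECCutLineWeakDisorderAcrossCutBlock
import Summits.AtomisticToContinuum.BoseEinsteinCondensation.Theorems.BECCutLineWeakDisorderAcrossCutTiltFTC
import HarnessLib

/-!
# Crux `TwoReplicaTransienceBound` (stmt-AtomisticToContinuum-9687), line `across-cut-thinning`:
# the registered stub `stub_blockOfCovariance` (tilt device ⇒ annealed block two-replica bound)

Support file (`--supports stmt-AtomisticToContinuum-9687`, lead c6; closes the registered PROVABLE stub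
`stub_blockOfCovariance : TiltFTC → BlockOfCovarianceReduction` of the line). For bounded measurable
`v`, `L > 0`, `T ≥ 0`, `κ₀ ≥ 0`: if the across-cut tilted dose covariance is `≤ κ₀` at all tilts in
`[0,1]²`, all junctions and all frozen path pairs, then `(∫ Z_n² dY)·∫ A_Q(Y)² dY ≤ e^{κ₀} (∫ A_Q Z_n dY)²`
for every dyadic block `Q` — the composition of the two landed halves: the pathwise four-point
inequality from the device (`stub_fourPointOfTilt`, `…AcrossCutFourPoint.lean`: realisation of
`crossTilt` as `tiltLaplace` on the two-sided bath space + `TiltFTC`) and the Tonelli reduction through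
the tracer factorisation (`stub_blockOfFourPoint`, `…AcrossCutBlock.lean`). With `stub_tiltFTC`
(`…AcrossCutTiltFTC.lean`, proved) this makes the whole DEVICE CHAIN of the line a theorem of the tree:
for bounded `v`, `CrossCovarianceBoundBdd` ⇒ the annealed kinetic-block two-replica bound.
-/

noncomputable section

open MeasureTheory Filter Set Finset
open scoped ENNReal NNReal Topology BigOperators

namespace Summit.AtomisticToContinuum.BoseEinsteinCondensation.Cruxes.TwoReplicaTransienceBound.AcrossCutThinning

open Literature.MathematicalPhysics.QuantumManyBody.BoseGas

/-- **Registered stub `stub_blockOfCovariance`** (line `across-cut-thinning`): `TiltFTC →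
BlockOfCovarianceReduction` — four-point inequality from the device, then Tonelli through the tracer. -/
theorem stub_blockOfCovariance : Goal.stub_blockOfCovariance :=
  fun hFTC n v hv hbdd L T _hL hT κ₀ hκ₀ hC j i =>
    stub_blockOfFourPoint n v hv L T (ENNReal.ofReal (Real.exp κ₀))
      (fun x x' ω₀ ω₀' => stub_fourPointOfTilt hFTC n v hv hbdd L T hT κ₀ hκ₀ x x' ω₀ ω₀'
        (fun s t hs ht => hC s t hs ht x x' ω₀ ω₀')) j i

/-- The device chain of the line as ONE implication: the abstract tilt device and the per-parameter
covariance hypothesis give the annealed block two-replica bound (`= stub_blockOfCovariance stub_tiltFTC`). -/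
theorem blockOfCovarianceReduction : BlockOfCovarianceReduction := stub_blockOfCovariance stub_tiltFTC

end Summit.AtomisticToContinuum.BoseEinsteinCondensation.Cruxes.TwoReplicaTransienceBound.AcrossCutThinning

end
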